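import Mathlib
import Summits.PneNP.PneNP.Theorems.CnfIdealGenLengthRankDefectRepresentationsQuadrantCapture

/-!
# Crux `RankDefectRepresentations` (stmt-PneNP-18923), line `rank-dehn-ladder`: SCHUR DOMINATION — of two blocks coupled inside a matrix of
# rank `≤ r`, one determines the other up to rank `4 (r − rank A)` through a FIXED generalised inverse (lead g14; memo
# `Cruxes/RankDefectRepresentations/Lines/rank-dehn-ladder-g14.md` §3(c))

The elementary linear algebra behind the ANTIPODAL DICHOTOMY of the line's memo g14 §3(c).  For a block matrix `M = [[A, E], [F, B]]` (written
here as a sum of four matrices with disjoint supports on one index set) and ANY generalised inverse `G` of `A` (`A G A = A`, `G` supported on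
the transposed support of `A`):

  `rank (B − F G E) + 4·rank A ≤ 4·rank M`, i.e. `rank (B − F G E) ≤ 4 (rank M − rank A)` (`schur_domination`).

[Column operations `M ↦ M (1 − G E)` and row operations `M ↦ (1 − F G) M` (both unipotent) turn `M` into `[[A, E₂], [F₂, S]]` with `E₂ = E − A G E`,
`F₂ = F − F G A`, `S = B − F G E − F G E₂`; `rank A + rank E₂ ≤ rank [A, E]` because `1 − A G` kills the column space of `A` and maps that of
`[A, E]` onto that of `E₂` (`rank_add_le_of_killed`); `rank A + rank S ≤ rank [[A,E₂],[F₂,S]] + rank E₂ + rank F₂`.]  Every matrix over a field has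
such a generalised inverse, of no larger rank (`exists_gInverse`).  Use on the line (memo §3(c)): for a two-family instance and ANY pair of cuts
`(B,B′)`, fixing one rectangle `A = R¹¹(S₁,S₁′)` of the quadrant `B × B′`, the single matrix `W = C′ G C` (`C = R(B,B′)`, `C′ = R(Bᶜ,B′ᶜ)`, rank
`≤ rank A`) has `rank (R²²(S₂,S₂′) − W|block) ≤ 4 (c₀ − rank A)` for EVERY rectangle of the antipodal quadrant `Bᶜ × B′ᶜ`, because
`[[A, ·],[·, R²²(S₂,S₂′)]]` is a sub-block of the rectangle `R(S₁ ∪ S₂, S₁′ ∪ S₂′)`: an antipodal quadrant within `δ` of saturation forces the other to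
be a rank-`c₀` matrix plus an instance of cut budget `4δ`.
HONEST FRAMING: negative-lane tool; `stub_merge` / `stub_coreLinear` and the crux stay open; P ≠ NP is not moved; F-N2 is a FRONTIER formal rung.
-/

set_option linter.dupNamespace false -- `Summit.PneNP.PneNP.…`: summit = sub-problem name (D-0017)

namespace Summit.PneNP.PneNP.Theorems.CnfIdealGenLengthRankDefectRepresentationsSchurDomination

open Matrix Finset
open Summit.PneNP.PneNP.Theorems.CnfIdealGenLengthRankDefectRepresentationsMergeLowerBound (rank_add_le' rank_sub_le')
open Summit.PneNP.PneNP.Theorems.CnfIdealGenLengthRankDefectRepresentationsStripCompletion (rank_mask_le)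
open Summit.PneNP.PneNP.Theorems.CnfIdealGenLengthRankDefectRepresentationsQuadrantCapture (rank_add_of_disjoint)

variable {K : Type} [Field K]

section GInverse

variable {ι ι' : Type} [Fintype ι] [Fintype ι'] [DecidableEq ι] [DecidableEq ι']

/-- 0/1 diagonal mask of a predicate. -/
def dmask (K : Type) [Field K] {α : Type} [DecidableEq α] (p : α → Prop) [DecidablePred p] : Matrix α α K :=
  Matrix.diagonal fun x => if p x then 1 else 0

omit [Fintype ι'] [DecidableEq ι'] in
/-- Left multiplication by a mask zeroes the other rows. -/
theorem dmask_mul_apply (p : ι → Prop) [DecidablePred p] (M : Matrix ι ι' K) (x : ι) (y : ι') :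
    (dmask K p * M) x y = if p x then M x y else 0 := by
  simp only [dmask, Matrix.diagonal_mul]; split_ifs <;> simp

omit [Fintype ι] [DecidableEq ι] in
/-- Right multiplication by a mask zeroes the other columns. -/
theorem mul_dmask_apply (q : ι' → Prop) [DecidablePred q] (M : Matrix ι ι' K) (x : ι) (y : ι') :
    (M * dmask K q) x y = if q y then M x y else 0 := by
  simp only [dmask, Matrix.mul_diagonal]; split_ifs <;> simp

omit [Fintype ι'] [DecidableEq ι'] in
/-- A matrix supported on the rows `p` is fixed by the row mask. -/
theorem dmask_mul_of_rows (p : ι → Prop) [DecidablePred p] (M : Matrix ι ι' K) (hM : ∀ x y, ¬ p x → M x y = 0) :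
    dmask K p * M = M := by
  ext x y; rw [dmask_mul_apply]; by_cases hx : p x
  · simp [hx]
  · simp only [hx, if_false]; exact (hM x y hx).symm

omit [Fintype ι] [DecidableEq ι] in
/-- A matrix supported on the columns `q` is fixed by the column mask. -/
theorem mul_dmask_of_cols (q : ι' → Prop) [DecidablePred q] (M : Matrix ι ι' K) (hM : ∀ x y, ¬ q y → M x y = 0) :
    M * dmask K q = M := by
  ext x y; rw [mul_dmask_apply]; by_cases hy : q y
  · simp [hy]
  · simp only [hy, if_false]; exact (hM x y hy).symm

omit [Fintype ι'] [DecidableEq ι'] in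
/-- A matrix vanishing on the rows `p` is killed by the row mask. -/
theorem dmask_mul_eq_zero (p : ι → Prop) [DecidablePred p] (M : Matrix ι ι' K) (hM : ∀ x y, p x → M x y = 0) :
    dmask K p * M = 0 := by
  ext x y; rw [dmask_mul_apply, Matrix.zero_apply]; by_cases hx : p x
  · rw [if_pos hx]; exact hM x y hx
  · rw [if_neg hx]

omit [Fintype ι] [DecidableEq ι] in
/-- A matrix vanishing on the columns `q` is killed by the column mask. -/
theorem mul_dmask_eq_zero (q : ι' → Prop) [DecidablePred q] (M : Matrix ι ι' K) (hM : ∀ x y, q y → M x y = 0) :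
    M * dmask K q = 0 := by
  ext x y; rw [mul_dmask_apply, Matrix.zero_apply]; by_cases hy : q y
  · rw [if_pos hy]; exact hM x y hy
  · rw [if_neg hy]

/-- **Generalised inverses exist** (over a field), of no larger rank, with the transposed support: if `A` is supported on rows `p` and columns
`q` then there is `G` supported on rows `q` and columns `p` with `A G A = A` and `rank G ≤ rank A`. [folklore] -/
theorem exists_gInverse (A : Matrix ι ι' K) (p : ι → Prop) (q : ι' → Prop) [DecidablePred p] [DecidablePred q]
    (hAp : ∀ x y, ¬ p x → A x y = 0) (hAq : ∀ x y, ¬ q y → A x y = 0) :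
    ∃ G : Matrix ι' ι K, A * G * A = A ∧ G.rank ≤ A.rank ∧
      (∀ y x, ¬ q y → G y x = 0) ∧ (∀ y x, ¬ p x → G y x = 0) := by
  classical
  set f : (ι' → K) →ₗ[K] (ι → K) := Matrix.toLin' A with hf
  -- a right inverse of the range restriction and a projection onto the range
  obtain ⟨s, hs⟩ := LinearMap.exists_rightInverse_of_surjective f.rangeRestrict (LinearMap.range_rangeRestrict f)
  obtain ⟨C, hC⟩ := (LinearMap.range f).exists_isCompl
  set π : (ι → K) →ₗ[K] LinearMap.range f := (LinearMap.range f).projectionOnto C hC with hπ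
  set S : Matrix ι' ι K := LinearMap.toMatrix' (s ∘ₗ π) with hS
  have hfs : ∀ w : LinearMap.range f, f (s w) = (w : ι → K) := by
    intro w
    have h1 := LinearMap.congr_fun hs w
    rw [LinearMap.comp_apply, LinearMap.id_apply] at h1
    have h2 := congrArg Subtype.val h1
    exact h2
  -- `A * S * A = A`
  have hASA : A * S * A = A := by
    apply Matrix.toLin'.injective
    rw [Matrix.toLin'_mul, Matrix.toLin'_mul, hS, Matrix.toLin'_toMatrix', ← hf]
    apply LinearMap.ext; intro v
    simp only [LinearMap.comp_apply]
    have hmem : f v ∈ LinearMap.range f := LinearMap.mem_range_self f v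
    have hπv : π (f v) = ⟨f v, hmem⟩ := by rw [hπ]; exact Submodule.projectionOnto_apply_of_mem_left hC hmem
    rw [hπv, hfs]
  refine ⟨dmask K q * S * dmask K p, ?_, ?_, ?_, ?_⟩
  · -- `A (Mq S Mp) A = (A Mq) S (Mp A) = A S A = A`
    have e : A * (dmask K q * S * dmask K p) * A = (A * dmask K q) * S * (dmask K p * A) := by
      simp only [Matrix.mul_assoc]
    rw [e, mul_dmask_of_cols q A hAq, dmask_mul_of_rows p A hAp, hASA]
  · -- rank
    calc (dmask K q * S * dmask K p).rank ≤ (dmask K q * S).rank := Matrix.rank_mul_le_left _ _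
      _ ≤ S.rank := Matrix.rank_mul_le_right _ _
      _ ≤ A.rank := by
          rw [Matrix.rank, Matrix.rank, ← Matrix.toLin'_apply', ← Matrix.toLin'_apply', hS, Matrix.toLin'_toMatrix', ← hf,
            LinearMap.range_comp]
          calc Module.finrank K (Submodule.map s (LinearMap.range π))
              ≤ Module.finrank K (LinearMap.range π) := Submodule.finrank_map_le _ _
            _ ≤ Module.finrank K (LinearMap.range f) := Submodule.finrank_le _
  · intro y x hy; rw [Matrix.mul_assoc, dmask_mul_apply, if_neg hy]
  · intro y x hx; rw [mul_dmask_apply, if_neg hx]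

end GInverse

/-! ## Schur domination for four blocks on one index set -/

section Schur

variable {ι ι' : Type} [Fintype ι] [Fintype ι'] [DecidableEq ι] [DecidableEq ι']

/-- If `A G A = A` and `A`, `E` occupy disjoint column sets (`A` on `¬q`, `E` on `q`), then `rank A + rank ((1 − A G) E) ≤ rank (A + E)`:
on the column space of `A + E` the map `1 − A G` has the column space of `A` in its kernel and the column space of `(1 − A G) E` in its image.
[folklore] -/
theorem rank_add_le_of_killed (A E : Matrix ι ι' K) (G : Matrix ι' ι K) (hG : A * G * A = A)
    (q : ι' → Prop) [DecidablePred q] (hAq : ∀ x y, q y → A x y = 0) (hEq : ∀ x y, ¬ q y → E x y = 0) :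
    A.rank + ((1 - A * G) * E).rank ≤ (A + E).rank := by
  classical
  set T : Matrix ι ι K := 1 - A * G with hT
  set X : Matrix ι ι' K := A + E with hX
  have hTA : T * A = 0 := by rw [hT, Matrix.sub_mul, Matrix.one_mul, hG, sub_self]
  -- `X` restricted to the `¬q` columns is `A`, to the `q` columns is `E`
  have hXA : X * dmask K (fun y => ¬ q y) = A := by
    rw [hX, Matrix.add_mul, mul_dmask_of_cols (fun y => ¬ q y) A (fun x y hy => hAq x y (not_not.mp hy)),
      mul_dmask_eq_zero (fun y => ¬ q y) E hEq, add_zero]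
  have hXE : X * dmask K q = E := by
    rw [hX, Matrix.add_mul, mul_dmask_of_cols q E hEq, mul_dmask_eq_zero q A hAq, zero_add]
  -- the linear map `T` restricted to the column space of `X`
  set VX : Submodule K (ι → K) := LinearMap.range (Matrix.toLin' X) with hVX
  set τ : VX →ₗ[K] (ι → K) := (Matrix.toLin' T) ∘ₗ VX.subtype with hτ
  have hrn := LinearMap.finrank_range_add_finrank_ker τ
  -- (1) the column space of `A` lies in the kernel of `τ`
  have hker : Module.finrank K (LinearMap.range (Matrix.toLin' A)) ≤ Module.finrank K (LinearMap.ker τ) := by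
    -- the map `range A → ker τ`
    have hAle : LinearMap.range (Matrix.toLin' A) ≤ VX := by
      rw [← hXA, Matrix.toLin'_mul]; exact LinearMap.range_comp_le_range _ _
    let j : LinearMap.range (Matrix.toLin' A) →ₗ[K] VX := Submodule.inclusion hAle
    have hj : Function.Injective j := Submodule.inclusion_injective hAle
    have hjker : LinearMap.range j ≤ LinearMap.ker τ := by
      rintro _ ⟨⟨v, hv⟩, rfl⟩
      obtain ⟨u, rfl⟩ := hv
      simp only [LinearMap.mem_ker, hτ, LinearMap.comp_apply, Submodule.subtype_apply, Submodule.coe_inclusion, j]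
      rw [← LinearMap.comp_apply, ← Matrix.toLin'_mul, hTA, map_zero, LinearMap.zero_apply]
    calc Module.finrank K (LinearMap.range (Matrix.toLin' A))
        = Module.finrank K (LinearMap.range j) := (LinearMap.finrank_range_of_inj hj).symm
      _ ≤ Module.finrank K (LinearMap.ker τ) := Submodule.finrank_mono hjker
  -- (2) the column space of `T E` lies in the range of `τ`
  have hran : Module.finrank K (LinearMap.range (Matrix.toLin' (T * E))) ≤ Module.finrank K (LinearMap.range τ) := by
    apply Submodule.finrank_mono
    rintro _ ⟨u, rfl⟩
    have hmem : Matrix.toLin' X (Matrix.toLin' (dmask K q) u) ∈ VX := LinearMap.mem_range_self _ _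
    refine ⟨⟨_, hmem⟩, ?_⟩
    simp only [hτ, LinearMap.comp_apply, Submodule.subtype_apply]
    rw [← hXE, Matrix.toLin'_mul, Matrix.toLin'_mul]
    rfl
  -- assemble
  have e1 : A.rank = Module.finrank K (LinearMap.range (Matrix.toLin' A)) := by rw [Matrix.rank, Matrix.toLin'_apply']
  have e2 : (T * E).rank = Module.finrank K (LinearMap.range (Matrix.toLin' (T * E))) := by rw [Matrix.rank, Matrix.toLin'_apply']
  have e3 : X.rank = Module.finrank K VX := by rw [Matrix.rank, hVX, Matrix.toLin'_apply']
  rw [e1, e2, e3]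
  omega

/-- **SCHUR DOMINATION.**  Four blocks `A, E, F, B` with disjoint supports (`A` on `p × qᶜ`-type positions as below: rows `p`/`¬p`, columns
`¬q`/`q`), `M = A + E + F + B`, and a generalised inverse `G` of `A` supported on the transposed support of `A`:
`rank (B − F G E) + 4 rank A ≤ 4 rank M`. -/
theorem schur_domination (A E F B : Matrix ι ι' K) (G : Matrix ι' ι K) (p : ι → Prop) (q : ι' → Prop) [DecidablePred p] [DecidablePred q]
    (hAp : ∀ x y, ¬ p x → A x y = 0) (hAq : ∀ x y, q y → A x y = 0)
    (hEp : ∀ x y, ¬ p x → E x y = 0) (hEq : ∀ x y, ¬ q y → E x y = 0)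
    (hFp : ∀ x y, p x → F x y = 0) (hFq : ∀ x y, q y → F x y = 0)
    (hBp : ∀ x y, p x → B x y = 0) (hBq : ∀ x y, ¬ q y → B x y = 0)
    (hG : A * G * A = A) (hGq : ∀ y x, q y → G y x = 0) (hGp : ∀ y x, ¬ p x → G y x = 0) :
    (B - F * G * E).rank + 4 * A.rank ≤ 4 * (A + E + F + B).rank := by
  classical
  set M : Matrix ι ι' K := A + E + F + B with hM
  -- products that vanish by support: `E G = 0`, `B G = 0`, `G F = 0`, `G B = 0`
  have hEG : E * G = 0 := by
    ext x z; simp only [Matrix.mul_apply, Matrix.zero_apply]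
    refine Finset.sum_eq_zero fun y _ => ?_
    by_cases hy : q y
    · rw [hGq y z hy, mul_zero]
    · rw [hEq x y hy, zero_mul]
  have hBG : B * G = 0 := by
    ext x z; simp only [Matrix.mul_apply, Matrix.zero_apply]
    refine Finset.sum_eq_zero fun y _ => ?_
    by_cases hy : q y
    · rw [hGq y z hy, mul_zero]
    · rw [hBq x y hy, zero_mul]
  have hGF : G * F = 0 := by
    ext y z; simp only [Matrix.mul_apply, Matrix.zero_apply]
    refine Finset.sum_eq_zero fun x _ => ?_
    by_cases hx : p x
    · rw [hFp x z hx, mul_zero]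
    · rw [hGp y x hx, zero_mul]
  have hGB : G * B = 0 := by
    ext y z; simp only [Matrix.mul_apply, Matrix.zero_apply]
    refine Finset.sum_eq_zero fun x _ => ?_
    by_cases hx : p x
    · rw [hBp x z hx, mul_zero]
    · rw [hGp y x hx, zero_mul]
  -- the transformed blocks
  set E₂ : Matrix ι ι' K := (1 - A * G) * E with hE₂
  set F₂ : Matrix ι ι' K := F * (1 - G * A) with hF₂
  set S : Matrix ι ι' K := B - F * G * E - F * G * E₂ with hSdef
  -- the unipotent operations
  set U : Matrix ι ι K := 1 - F * G with hU
  set V : Matrix ι' ι' K := 1 - G * E with hV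
  have hUinv : IsUnit U.det := by
    have hz : F * G * (F * G) = 0 := by
      rw [Matrix.mul_assoc, ← Matrix.mul_assoc G F G, hGF, Matrix.zero_mul, Matrix.mul_zero]
    have h : U * (1 + F * G) = 1 := by
      rw [hU, Matrix.sub_mul, Matrix.one_mul, Matrix.mul_add, Matrix.mul_one, hz, add_zero, add_sub_cancel_right]
    exact Matrix.isUnit_det_of_right_inverse h
  have hVinv : IsUnit V.det := by
    have hz : G * E * (G * E) = 0 := by
      rw [Matrix.mul_assoc, ← Matrix.mul_assoc E G E, hEG, Matrix.zero_mul, Matrix.mul_zero]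
    have h : (1 + G * E) * V = 1 := by
      rw [hV, Matrix.mul_sub, Matrix.mul_one, Matrix.add_mul, Matrix.one_mul, hz, add_zero, add_sub_cancel_right]
    exact Matrix.isUnit_det_of_left_inverse h
  have hUMV : U * M * V = A + E₂ + F₂ + S := by
    -- expand; every surviving term is listed
    have hMV : M * V = A + E₂ + F + (B - F * G * E) := by
      rw [hM, hV, Matrix.mul_sub, Matrix.mul_one]
      have : (A + E + F + B) * (G * E) = A * G * E + F * G * E := by
        rw [Matrix.add_mul, Matrix.add_mul, Matrix.add_mul, ← Matrix.mul_assoc, ← Matrix.mul_assoc, ← Matrix.mul_assoc,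
          ← Matrix.mul_assoc, hEG, hBG, Matrix.zero_mul, add_zero, add_zero]
      rw [this, hE₂, Matrix.sub_mul, Matrix.one_mul]
      abel
    rw [Matrix.mul_assoc, hMV, hU, Matrix.sub_mul, Matrix.one_mul]
    have : F * G * (A + E₂ + F + (B - F * G * E)) = F * G * A + F * G * E₂ := by
      rw [Matrix.mul_add, Matrix.mul_add, Matrix.mul_add, Matrix.mul_sub]
      have h1 : F * G * F = 0 := by rw [Matrix.mul_assoc, hGF, Matrix.mul_zero]
      have h2 : F * G * B = 0 := by rw [Matrix.mul_assoc, hGB, Matrix.mul_zero]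
      have h3 : F * G * (F * G * E) = 0 := by
        rw [← Matrix.mul_assoc, ← Matrix.mul_assoc, Matrix.mul_assoc F G F, hGF, Matrix.mul_zero, Matrix.zero_mul, Matrix.zero_mul]
      rw [h1, h2, h3, sub_zero, add_zero, add_zero]
    rw [this, hF₂, hSdef, Matrix.mul_sub, Matrix.mul_one]
    simp only [Matrix.mul_assoc]
    abel
  have hrankM : (A + E₂ + F₂ + S).rank = M.rank := by
    rw [← hUMV, Matrix.rank_mul_eq_left_of_isUnit_det V _ hVinv, Matrix.rank_mul_eq_right_of_isUnit_det U _ hUinv]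
  -- supports of the transformed blocks
  have hAGp : ∀ x z, ¬ p x → (A * G) x z = 0 := by
    intro x z hx; simp only [Matrix.mul_apply]
    exact Finset.sum_eq_zero fun y _ => by rw [hAp x y hx, zero_mul]
  have hE₂p : ∀ x y, ¬ p x → E₂ x y = 0 := by
    intro x y hx
    rw [hE₂, Matrix.sub_mul, Matrix.one_mul, Matrix.sub_apply, hEp x y hx, Matrix.mul_apply,
      Finset.sum_eq_zero fun z _ => by rw [hAGp x z hx, zero_mul], sub_zero]
  have hE₂q : ∀ x y, ¬ q y → E₂ x y = 0 := by
    intro x y hy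
    rw [hE₂, Matrix.sub_mul, Matrix.one_mul, Matrix.sub_apply, hEq x y hy, Matrix.mul_apply,
      Finset.sum_eq_zero fun z _ => by rw [hEq z y hy, mul_zero], sub_zero]
  have hGAq : ∀ z y, q y → (G * A) z y = 0 := by
    intro z y hy; simp only [Matrix.mul_apply]
    exact Finset.sum_eq_zero fun x _ => by rw [hAq x y hy, mul_zero]
  have hF₂p : ∀ x y, p x → F₂ x y = 0 := by
    intro x y hx
    rw [hF₂, Matrix.mul_sub, Matrix.mul_one, Matrix.sub_apply, hFp x y hx, Matrix.mul_apply,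
      Finset.sum_eq_zero fun z _ => by rw [hFp x z hx, zero_mul], sub_zero]
  have hF₂q : ∀ x y, q y → F₂ x y = 0 := by
    intro x y hy
    rw [hF₂, Matrix.mul_sub, Matrix.mul_one, Matrix.sub_apply, hFq x y hy, Matrix.mul_apply,
      Finset.sum_eq_zero fun z _ => by rw [hGAq z y hy, mul_zero], sub_zero]
  have hFGXp : ∀ (X : Matrix ι ι' K) x y, p x → (F * G * X) x y = 0 := by
    intro X x y hx; rw [Matrix.mul_assoc, Matrix.mul_apply]
    exact Finset.sum_eq_zero fun z _ => by rw [hFp x z hx, zero_mul]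
  have hFGEq : ∀ (X : Matrix ι ι' K), (∀ x y, ¬ q y → X x y = 0) → ∀ x y, ¬ q y → (F * G * X) x y = 0 := by
    intro X hX x y hy; rw [Matrix.mul_apply]
    exact Finset.sum_eq_zero fun z _ => by rw [hX z y hy, mul_zero]
  have hSp : ∀ x y, p x → S x y = 0 := by
    intro x y hx; rw [hSdef, Matrix.sub_apply, Matrix.sub_apply, hBp x y hx, hFGXp E x y hx, hFGXp E₂ x y hx]; ring
  have hSq : ∀ x y, ¬ q y → S x y = 0 := by
    intro x y hy; rw [hSdef, Matrix.sub_apply, Matrix.sub_apply, hBq x y hy, hFGEq E hEq x y hy, hFGEq E₂ hE₂q x y hy]; ring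
  -- (i) `rank A + rank E₂ ≤ rank (A + E) ≤ rank M`
  have i1 : A.rank + E₂.rank ≤ M.rank := by
    refine (rank_add_le_of_killed A E G hG q hAq hEq).trans ?_
    have : A + E = dmask K p * M := by
      rw [hM, Matrix.mul_add, Matrix.mul_add, Matrix.mul_add, dmask_mul_of_rows p A hAp, dmask_mul_of_rows p E hEp,
        dmask_mul_eq_zero p F hFp, dmask_mul_eq_zero p B hBp, add_zero, add_zero]
    rw [this]; exact Matrix.rank_mul_le_right _ _
  -- (ii) `rank A + rank F₂ ≤ rank (A + F) ≤ rank M` (transpose of (i))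
  have i2 : A.rank + F₂.rank ≤ M.rank := by
    have hGt : Aᵀ * Gᵀ * Aᵀ = Aᵀ := by
      rw [← Matrix.transpose_mul, ← Matrix.transpose_mul, ← Matrix.mul_assoc, hG]
    have h := rank_add_le_of_killed Aᵀ Fᵀ Gᵀ hGt (fun x => ¬ p x) (fun y x hx => hAp x y hx)
      (fun y x hx => hFp x y (not_not.mp hx))
    have eF : (1 - Aᵀ * Gᵀ) * Fᵀ = F₂ᵀ := by
      rw [hF₂, Matrix.transpose_mul, Matrix.transpose_sub, Matrix.transpose_one, Matrix.transpose_mul]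
    rw [eF, Matrix.rank_transpose, Matrix.rank_transpose, ← Matrix.transpose_add, Matrix.rank_transpose] at h
    refine h.trans ?_
    have : A + F = M * dmask K (fun y => ¬ q y) := by
      rw [hM, Matrix.add_mul, Matrix.add_mul, Matrix.add_mul,
        mul_dmask_of_cols (fun y => ¬ q y) A (fun x y hy => hAq x y (not_not.mp hy)),
        mul_dmask_of_cols (fun y => ¬ q y) F (fun x y hy => hFq x y (not_not.mp hy)),
        mul_dmask_eq_zero (fun y => ¬ q y) E hEq, mul_dmask_eq_zero (fun y => ¬ q y) B hBq]
      abel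
    rw [this]; exact Matrix.rank_mul_le_left _ _
  -- (iii) `rank A + rank S ≤ rank (A + E₂ + F₂ + S) + rank E₂ + rank F₂`
  have i3 : A.rank + S.rank ≤ M.rank + E₂.rank + F₂.rank := by
    have hAsupp : ∀ x y, ¬ (p x ∧ ¬ q y) → A x y = 0 := by
      intro x y h
      by_cases hx : p x
      · exact hAq x y (not_not.mp (fun hy => h ⟨hx, hy⟩))
      · exact hAp x y hx
    have hSsupp : ∀ x y, ¬ (¬ p x ∧ ¬ ¬ q y) → S x y = 0 := by
      intro x y h
      by_cases hx : p x
      · exact hSp x y hx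
      · exact hSq x y (fun hy => h ⟨hx, not_not.mpr hy⟩)
    have hAS : (A + S).rank = A.rank + S.rank := rank_add_of_disjoint p (fun y => ¬ q y) A S hAsupp hSsupp
    have e : A + S = (A + E₂ + F₂ + S) - (E₂ + F₂) := by abel
    rw [← hAS, e]
    calc ((A + E₂ + F₂ + S) - (E₂ + F₂)).rank ≤ (A + E₂ + F₂ + S).rank + (E₂ + F₂).rank := rank_sub_le' _ _
      _ ≤ M.rank + (E₂.rank + F₂.rank) := by rw [hrankM]; exact Nat.add_le_add_left (rank_add_le' _ _) _
      _ = M.rank + E₂.rank + F₂.rank := (Nat.add_assoc _ _ _).symm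
  -- (iv) `rank (B − F G E) ≤ rank S + rank E₂`
  have i4 : (B - F * G * E).rank ≤ S.rank + E₂.rank := by
    have e : B - F * G * E = S + F * G * E₂ := by rw [hSdef]; abel
    rw [e]
    calc (S + F * G * E₂).rank ≤ S.rank + (F * G * E₂).rank := rank_add_le' _ _
      _ ≤ S.rank + E₂.rank := Nat.add_le_add_left (Matrix.rank_mul_le_right _ _) _
  omega

end Schur

end Summit.PneNP.PneNP.Theorems.CnfIdealGenLengthRankDefectRepresentationsSchurDomination
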